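import Literature.NumberTheory.EllipticCurves.KatoFineSelmerDual
import Literature.NumberTheory.EllipticCurves.SelmerInftyTorsionFiniteProofs
import Literature.NumberTheory.EllipticCurves.PeriodIndexCorestrictionLocal
import Literature.NumberTheory.EllipticCurves.H1CorestrictionIndexTwo
import Literature.NumberTheory.EllipticCurves.IsogenyGeomEndRingProofs
import HarnessLib

/-!
# The fine Selmer group `Sel₀(K_∞, M)` under a `Γ_K`-equivariant map of coefficients `M → M′`;
# `Sel₀(K_∞, E[p]) → Sel₀(K_∞, E[p^∞])[p]` (proved; no definition, no named fact)

`Proofs` file (theorems only) in topic `NumberTheory/EllipticCurves`, first brick of the discharge of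
the Literature fact `LimSujatha2018.prop32_fineSelmerDual_moduleFinite_iff_of_torsionIso`
(`FineSelmerCongruentCurves`: Lim–Sujatha 2018 Prop. 3.2, Coates–Sujatha's statement (A) is an
invariant of `E[p]`), following the printed proof (Lim–Sujatha, J. Number Theory 187 (2018) §3;
Greenberg, LNM 1716 §1): the fine Selmer group of the `p`-TORSION module `E[p]` is the bridge between
two congruent curves, and (A) is read off the `p`-torsion of `Sel₀(K_∞, E[p^∞])`.

* §1 `mem_strictKer_fineLocalDatum_iff`, `mem_fineSelmerInfty_iff_resOfLe`: for the FINE data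
  (`M⁺_v = 0` at every `v ∣ p`) Greenberg's strict condition at `v ∣ p` is "the restriction to
  `H ⊓ D_v` vanishes", exactly as at `v ∤ p`; so `c ∈ Sel₀(K_∞, M)` iff every conjugate `conj_σ c`
  restricts to zero on `H ⊓ D_v` (all finite `v`) and on `H ⊓ D_w` (all infinite `w`), `H = Gal(K̄/K_∞)`.
* §2 functoriality in the coefficients: for a `Γ_K`-equivariant additive map `ψ : M → M′` the induced
  map `ψ_* : H¹(H, M) → H¹(H, M′)` (`resH1Hom id ψ`) commutes with `conj_σ` and with restriction
  (`conjH1_comp_resH1Hom_id`, `resOfLe_comp_resH1Hom_id`), hence maps `Sel₀(K_∞, M)` into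
  `Sel₀(K_∞, M′)` (`resH1Hom_id_mem_fineSelmerInfty`); for an equivariant ISOMORPHISM `ψ` the two fine
  Selmer groups are in bijection, in particular one is finite iff the other is
  (`finite_fineSelmerInfty_iff_of_addEquiv`) — the transport step of Lim–Sujatha's proof
  ("`A[π] ≅ B[π]` … `R_S(A[π]/F^cyc) ≅ R_S(B[π]/F^cyc)`").
* §3 the case `ψ = (E[p] ↪ E[p^∞])`: the tree's `torsionToPrimaryH1Sub` maps `Sel₀(K_∞, E[p])` into the
  `p`-torsion of `Sel₀(K_∞, E[p^∞])` and has finite kernel (`finite_ker_torsionToPrimaryH1Sub`), so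
  **`Sel₀(K_∞, E[p^∞])[p]` finite ⟹ `Sel₀(K_∞, E[p])` finite**
  (`finite_fineSelmerInfty_torsion_of_finite_pTorsion`) — one half of Lim–Sujatha's Lemma
  "`R(A[π])` finite ⟺ `Y(A)` f.g. over `𝒪`"; the other half (local analysis) is a sibling file.

References: [LimSujatha2018] M. F. Lim, R. Sujatha, J. Number Theory 187 (2018) 66–91, §3
(Prop. 3.2 and the lemma before it); [GreenbergLNM1716] §1 p. 60, §3; [Greenberg1989] §1 p. 98;
[SerreGaloisCohomology1997] I.§2.4–2.5, I.§5.1.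
-/

set_option autoImplicit false

noncomputable section

open scoped Classical

universe u

namespace Literature.NumberTheory.EllipticCurves.FineSelmerCoefficientMap

open NumberField IsDedekindDomain Field
open Literature.NumberTheory.EllipticCurves Literature.NumberTheory.EllipticCurves.GreenbergSelmer
  Literature.NumberTheory.GaloisRepresentations WeierstrassCurve

/-! ## §1 The fine conditions as vanishing of restrictions -/

section Criterion

variable {K : Type u} [Field K] [NumberField K]
variable {M : Type u} [AddCommGroup M] [DistribMulAction (absoluteGaloisGroup K) M]
  [TopologicalSpace M] [DiscreteTopology M]

/-- **For the fine datum `M⁺_v = 0`, Greenberg's strict condition at `v` is "restriction to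
`H ⊓ D_v` vanishes".** The coefficient map `M → M ⧸ 0` is injective and `D_v`-equivariant, so the
class of a cocycle `φ` dies in `H¹(H ⊓ D_v, M ⧸ 0)` iff `φ` is principal on `H ⊓ D_v` iff its
restriction to `H ⊓ D_v` with coefficients in `M` vanishes. [cite: Greenberg1989, §1 p. 98 (the strict condition)] -/
theorem mem_strictKer_fineLocalDatum_iff (H : Subgroup (absoluteGaloisGroup K))
    (v : HeightOneSpectrum (𝓞 K)) (c : subgroupH1 H M) :
    c ∈ (fineLocalDatum M v).strictKer H ↔
      resOfLe M (inf_le_left : H ⊓ decomp v ≤ H) c = 0 := by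
  obtain ⟨φ, rfl⟩ := oneCocycleClass_surjective _ c
  rw [LocalDatum.mem_strictKer_iff, LocalDatum.strictMap, resH1Hom_oneCocycleClass,
    oneCocycleClass_eq_zero_iff, resOfLe, resH1Hom_oneCocycleClass, oneCocycleClass_eq_zero_iff]
  constructor
  · rintro ⟨tbar, htbar⟩
    obtain ⟨t, rfl⟩ := (fineLocalDatum M v).grMk_surjective tbar
    refine ⟨t, fun g ↦ ?_⟩
    have hg := Subgroup.mem_inf.1 g.2
    have h1 := htbar ⟨⟨(g : absoluteGaloisGroup K), hg.2⟩, (mem_decompIn_iff H v _).2 hg.1⟩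
    have h2 : (fineLocalDatum M v).grMk (φ.1 ⟨g, hg.1⟩) =
        (fineLocalDatum M v).grMk ((g : absoluteGaloisGroup K) • t - t) := by
      rw [map_sub]
      exact h1
    rw [← sub_eq_zero, ← map_sub, ← AddMonoidHom.mem_ker, LocalDatum.ker_grMk, fineLocalDatum_plus,
      AddSubgroup.mem_bot, sub_eq_zero] at h2
    exact h2
  · rintro ⟨t, ht⟩
    refine ⟨(fineLocalDatum M v).grMk t, fun g ↦ ?_⟩
    have hgD : ((g : decomp (K := K) v) : absoluteGaloisGroup K) ∈ decomp v := (g : decomp v).2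
    have hgH : ((g : decomp (K := K) v) : absoluteGaloisGroup K) ∈ H := (mem_decompIn_iff H v _).1 g.2
    have h1 := ht ⟨((g : decomp (K := K) v) : absoluteGaloisGroup K), Subgroup.mem_inf.2 ⟨hgH, hgD⟩⟩
    change (fineLocalDatum M v).grMk (φ.1 (decompInToH H v g)) =
      (g : decomp (K := K) v) • (fineLocalDatum M v).grMk t - (fineLocalDatum M v).grMk t
    rw [LocalDatum.smul_grMk, ← map_sub]
    exact congrArg _ h1

variable {p : ℕ} [Fact p.Prime] (κ : ZpExtension K p)

/-- **Membership in `Sel₀(K_∞, M)` as the vanishing of restrictions.** `c ∈ Sel₀(K_∞, M)` iff for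
every `σ ∈ Γ_K` the conjugate class `conj_σ c` restricts to zero on `H ⊓ D_v` for every finite place
`v` of `K` and on `H ⊓ D_w` for every infinite place `w` (`H = Gal(K̄/K_∞)`): the fine data impose the
same local condition — "locally trivial" — at `v ∣ p` as at `v ∤ p`
(`mem_strictKer_fineLocalDatum_iff`). [cite: Greenberg1989, §1 p. 98] [cite: CoatesSujatha2005, §3 (the definition of `R(E/F_∞)`)] -/
theorem mem_fineSelmerInfty_iff_resOfLe (c : subgroupH1 κ.kerSubgroup M) :
    c ∈ fineSelmerInfty M κ ↔
      (∀ (v : HeightOneSpectrum (𝓞 K)) (σ : absoluteGaloisGroup K),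
          resOfLe M (inf_le_left : κ.kerSubgroup ⊓ decomp v ≤ κ.kerSubgroup)
            (conjH1 κ.kerSubgroup M σ c) = 0) ∧
        ∀ (w : InfinitePlace K) (σ : absoluteGaloisGroup K),
          resOfLe M (inf_le_left : κ.kerSubgroup ⊓ decompInf w ≤ κ.kerSubgroup)
            (conjH1 κ.kerSubgroup M σ c) = 0 := by
  rw [fineSelmerInfty_eq, strictSelmerInfty, mem_strictSelmerGroupOver_iff]
  constructor
  · rintro ⟨h1, h2, h3⟩
    refine ⟨fun v σ ↦ ?_, fun w σ ↦ h2 w σ⟩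
    by_cases hv : ((p : ℕ) : 𝓞 K) ∈ v.asIdeal
    · exact (mem_strictKer_fineLocalDatum_iff _ v _).1 (h3 v hv σ)
    · exact h1 v hv σ
  · rintro ⟨h1, h2⟩
    exact ⟨fun v _ σ ↦ h1 v σ, fun w σ ↦ h2 w σ,
      fun v _ σ ↦ (mem_strictKer_fineLocalDatum_iff _ v _).2 (h1 v σ)⟩

end Criterion

/-! ## §2 Functoriality of `Sel₀(K_∞, ·)` in the coefficients -/

section Functorial

variable {K : Type u} [Field K] [NumberField K]
variable {M : Type u} [AddCommGroup M] [DistribMulAction (absoluteGaloisGroup K) M]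
  [TopologicalSpace M] [DiscreteTopology M]
variable {M' : Type u} [AddCommGroup M'] [DistribMulAction (absoluteGaloisGroup K) M']
  [TopologicalSpace M'] [DiscreteTopology M']

omit [NumberField K] in
/-- **`ψ_*` commutes with conjugation**: for a `Γ_K`-equivariant `ψ : M → M′` and a normal `H ≤ Γ_K`,
`conj_σ ∘ ψ_* = ψ_* ∘ conj_σ` on `H¹(H, ·)` (both are induced by the compatible pair
`(h ↦ σ⁻¹hσ, m ↦ σ • ψ m = ψ (σ • m))`, `resH1Hom_comp`). [cite: SerreGaloisCohomology1997, I.§2.4–2.5] -/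
theorem conjH1_comp_resH1Hom_id (H : Subgroup (absoluteGaloisGroup K)) [H.Normal] (ψ : M →+ M')
    (hψ : ∀ (x : H) (m : M), ψ (ContinuousMonoidHom.id H x • m) = x • ψ m)
    (hψ' : ∀ (g : absoluteGaloisGroup K) (m : M), ψ (g • m) = g • ψ m)
    (σ : absoluteGaloisGroup K) :
    (conjH1 H M' σ).comp (resH1Hom (ContinuousMonoidHom.id H) ψ hψ) =
      (resH1Hom (ContinuousMonoidHom.id H) ψ hψ).comp (conjH1 H M σ) := by
  rw [conjH1, conjH1, resH1Hom_comp, resH1Hom_comp]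
  exact resH1Hom_congr (ContinuousMonoidHom.ext fun _ ↦ rfl)
    (AddMonoidHom.ext fun m ↦ (hψ' σ m).symm) _ _

omit [NumberField K] in
/-- **`ψ_*` commutes with restriction** to a subgroup `H₁ ≤ H₂` (`resH1Hom_comp`).
[cite: SerreGaloisCohomology1997, I.§2.4] -/
theorem resOfLe_comp_resH1Hom_id {H₁ H₂ : Subgroup (absoluteGaloisGroup K)} (hle : H₁ ≤ H₂)
    (ψ : M →+ M')
    (hψ₂ : ∀ (x : H₂) (m : M), ψ (ContinuousMonoidHom.id H₂ x • m) = x • ψ m)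
    (hψ₁ : ∀ (x : H₁) (m : M), ψ (ContinuousMonoidHom.id H₁ x • m) = x • ψ m) :
    (resOfLe M' hle).comp (resH1Hom (ContinuousMonoidHom.id H₂) ψ hψ₂) =
      (resH1Hom (ContinuousMonoidHom.id H₁) ψ hψ₁).comp (resOfLe M hle) := by
  rw [resOfLe, resOfLe, resH1Hom_comp, resH1Hom_comp]
  exact resH1Hom_congr (ContinuousMonoidHom.ext fun _ ↦ rfl) (AddMonoidHom.ext fun _ ↦ rfl) _ _

variable {p : ℕ} [Fact p.Prime] (κ : ZpExtension K p)

/-- **A `Γ_K`-equivariant map of coefficients maps `Sel₀(K_∞, M)` into `Sel₀(K_∞, M′)`**: every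
fine condition is "a restriction of a conjugate vanishes" (`mem_fineSelmerInfty_iff_resOfLe`) and
`ψ_*` commutes with conjugation and restriction. [cite: LimSujatha2018, §3 (functoriality of `R_S(·/𝓛)`)] -/
theorem resH1Hom_id_mem_fineSelmerInfty (ψ : M →+ M')
    (hψ' : ∀ (g : absoluteGaloisGroup K) (m : M), ψ (g • m) = g • ψ m)
    (hψ : ∀ (x : κ.kerSubgroup) (m : M), ψ (ContinuousMonoidHom.id κ.kerSubgroup x • m) = x • ψ m)
    {c : subgroupH1 κ.kerSubgroup M} (hc : c ∈ fineSelmerInfty M κ) :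
    resH1Hom (ContinuousMonoidHom.id κ.kerSubgroup) ψ hψ c ∈ fineSelmerInfty M' κ := by
  rw [mem_fineSelmerInfty_iff_resOfLe] at hc ⊢
  have hconj : ∀ σ : absoluteGaloisGroup K,
      conjH1 κ.kerSubgroup M' σ (resH1Hom (ContinuousMonoidHom.id κ.kerSubgroup) ψ hψ c) =
        resH1Hom (ContinuousMonoidHom.id κ.kerSubgroup) ψ hψ (conjH1 κ.kerSubgroup M σ c) :=
    fun σ ↦ congrArg (fun f : subgroupH1 κ.kerSubgroup M →+ subgroupH1 κ.kerSubgroup M' ↦ f c)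
      (conjH1_comp_resH1Hom_id κ.kerSubgroup ψ hψ hψ' σ)
  refine ⟨fun v σ ↦ ?_, fun w σ ↦ ?_⟩
  · rw [hconj]
    have e := congrArg (fun f : subgroupH1 κ.kerSubgroup M →+
        subgroupH1 (κ.kerSubgroup ⊓ decomp v) M' ↦ f (conjH1 κ.kerSubgroup M σ c))
      (resOfLe_comp_resH1Hom_id (inf_le_left : κ.kerSubgroup ⊓ decomp v ≤ κ.kerSubgroup) ψ hψ
        (fun x m ↦ hψ' x m))
    simp only [AddMonoidHom.comp_apply] at e
    rw [e, (hc.1 v σ), map_zero]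
  · rw [hconj]
    have e := congrArg (fun f : subgroupH1 κ.kerSubgroup M →+
        subgroupH1 (κ.kerSubgroup ⊓ decompInf w) M' ↦ f (conjH1 κ.kerSubgroup M σ c))
      (resOfLe_comp_resH1Hom_id (inf_le_left : κ.kerSubgroup ⊓ decompInf w ≤ κ.kerSubgroup) ψ hψ
        (fun x m ↦ hψ' x m))
    simp only [AddMonoidHom.comp_apply] at e
    rw [e, (hc.2 w σ), map_zero]

omit [NumberField K] in
/-- `(ψ⁻¹)_* ∘ ψ_* = id` on `H¹(H, M)` for an equivariant additive isomorphism `ψ`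
(`resH1Hom_comp`, `resH1Hom_id`). [cite: SerreGaloisCohomology1997, I.§2.4] -/
theorem resH1Hom_id_symm_comp (H : Subgroup (absoluteGaloisGroup K)) (ψ : M ≃+ M')
    (hψ : ∀ (x : H) (m : M), (ψ : M →+ M') (ContinuousMonoidHom.id H x • m) = x • (ψ : M →+ M') m)
    (hψs : ∀ (x : H) (m : M'),
      (ψ.symm : M' →+ M) (ContinuousMonoidHom.id H x • m) = x • (ψ.symm : M' →+ M) m) :
    (resH1Hom (ContinuousMonoidHom.id H) (ψ.symm : M' →+ M) hψs).comp
        (resH1Hom (ContinuousMonoidHom.id H) (ψ : M →+ M') hψ) = AddMonoidHom.id _ := by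
  rw [resH1Hom_comp, ← resH1Hom_id]
  exact resH1Hom_congr (ContinuousMonoidHom.ext fun _ ↦ rfl)
    (AddMonoidHom.ext fun m ↦ ψ.symm_apply_apply m) _ _

/-- **Transport of `Sel₀(K_∞, ·)` along an equivariant isomorphism of coefficients**: for a
`Γ_K`-equivariant additive isomorphism `ψ : M ≃ M′`, `ψ_*` restricts to a bijection
`Sel₀(K_∞, M) ≃ Sel₀(K_∞, M′)`; in particular one is finite iff the other is — the transport step
of Lim–Sujatha's proof of Prop. 3.2 (`R_S(A[π]/F^cyc) ≅ R_S(B[π]/F^cyc)` for `A[π] ≅ B[π]`).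
[cite: LimSujatha2018, §3 Prop. 3.2 (proof)] -/
theorem finite_fineSelmerInfty_iff_of_addEquiv (ψ : M ≃+ M')
    (hψ' : ∀ (g : absoluteGaloisGroup K) (m : M), ψ (g • m) = g • ψ m) :
    (fineSelmerInfty M κ : Set (subgroupH1 κ.kerSubgroup M)).Finite ↔
      (fineSelmerInfty M' κ : Set (subgroupH1 κ.kerSubgroup M')).Finite := by
  have hψs' : ∀ (g : absoluteGaloisGroup K) (m : M'), ψ.symm (g • m) = g • ψ.symm m := fun g m ↦ by
    apply ψ.injective
    rw [ψ.apply_symm_apply, hψ', ψ.apply_symm_apply]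
  have hψ : ∀ (x : κ.kerSubgroup) (m : M),
      (ψ : M →+ M') (ContinuousMonoidHom.id κ.kerSubgroup x • m) = x • (ψ : M →+ M') m :=
    fun x m ↦ hψ' x m
  have hψs : ∀ (x : κ.kerSubgroup) (m : M'),
      (ψ.symm : M' →+ M) (ContinuousMonoidHom.id κ.kerSubgroup x • m) =
        x • (ψ.symm : M' →+ M) m := fun x m ↦ hψs' x m
  set F := resH1Hom (ContinuousMonoidHom.id κ.kerSubgroup) (ψ : M →+ M') hψ with hF
  set G := resH1Hom (ContinuousMonoidHom.id κ.kerSubgroup) (ψ.symm : M' →+ M) hψs with hG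
  have hGF : ∀ c, G (F c) = c := fun c ↦
    congrArg (fun f : subgroupH1 κ.kerSubgroup M →+ subgroupH1 κ.kerSubgroup M ↦ f c)
      (resH1Hom_id_symm_comp κ.kerSubgroup ψ hψ hψs)
  have hFG : ∀ c, F (G c) = c := fun c ↦ by
    have e := resH1Hom_id_symm_comp κ.kerSubgroup ψ.symm hψs
      (fun x m ↦ by rw [AddEquiv.symm_symm]; exact hψ x m)
    have e' := congrArg (fun f : subgroupH1 κ.kerSubgroup M' →+ subgroupH1 κ.kerSubgroup M' ↦ f c) e
    simp only [AddMonoidHom.comp_apply, AddMonoidHom.id_apply] at e'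
    rw [hF]
    convert e' using 2
    exact resH1Hom_congr rfl (by rw [AddEquiv.symm_symm]) _ _
  have hFmem : ∀ c ∈ fineSelmerInfty M κ, F c ∈ fineSelmerInfty M' κ := fun c hc ↦
    resH1Hom_id_mem_fineSelmerInfty κ (ψ : M →+ M') (fun g m ↦ hψ' g m) hψ hc
  have hGmem : ∀ c ∈ fineSelmerInfty M' κ, G c ∈ fineSelmerInfty M κ := fun c hc ↦
    resH1Hom_id_mem_fineSelmerInfty κ (ψ.symm : M' →+ M) (fun g m ↦ hψs' g m) hψs hc
  constructor
  · intro hfin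
    refine (hfin.image F).subset fun c hc ↦ ⟨G c, hGmem c hc, hFG c⟩
  · intro hfin
    refine (hfin.image G).subset fun c hc ↦ ⟨F c, hFmem c hc, hGF c⟩

end Functorial

/-! ## §3 `Sel₀(K_∞, E[p]) → Sel₀(K_∞, E[p^∞])[p]` -/

section Torsion

variable {K : Type u} [Field K] [NumberField K] (W : WeierstrassCurve K) {p : ℕ} [Fact p.Prime]
  (κ : ZpExtension K p)

omit [NumberField K] [Fact p.Prime] in
/-- `H¹(H, E[p])` is killed by `p` (its coefficients are; classes are represented by cocycles,
Serre I.§2.2). [cite: SerreGaloisCohomology1997, I.§2.2] -/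
theorem p_smul_subgroupH1_geomTorsion_eq_zero (H : Subgroup (absoluteGaloisGroup K))
    (y : subgroupH1 H (geomTorsion W (p : ℤ))) : p • y = 0 := by
  obtain ⟨φ, rfl⟩ := oneCocycleClass_surjective _ y
  have h := oneCocycleClass_smul (discreteTopRep H (geomTorsion W (p : ℤ))) (p : ℤ) φ
  have hφ : (p : ℤ) • φ = 0 := by
    apply Subtype.ext
    ext g
    change (((p : ℤ) • φ.1 g : geomTorsion W (p : ℤ)) : geomPoints W) = 0
    rw [AddSubgroupClass.coe_zsmul]
    exact (φ.1 g).2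
  rw [← Nat.cast_smul_eq_nsmul ℤ, ← h, hφ, oneCocycleClass_zero]

/-- **`(E[p] ↪ E[p^∞])_*` maps `Sel₀(K_∞, E[p])` into `Sel₀(K_∞, E[p^∞])`** (functoriality of the
fine Selmer group in the coefficients, `resH1Hom_id_mem_fineSelmerInfty`; the tree's
`torsionToPrimaryH1Sub` is `resH1Hom id (E[p] ↪ E[p^∞])`). [cite: LimSujatha2018, §3 (the map `R_S(A[π]) → R_S(A)[π]`)] -/
theorem torsionToPrimaryH1Sub_mem_fineSelmerInfty
    {y : subgroupH1 κ.kerSubgroup (geomTorsion W (p : ℤ))}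
    (hy : y ∈ fineSelmerInfty (↥(geomTorsion W (p : ℤ))) κ) :
    W.torsionToPrimaryH1Sub p κ.kerSubgroup y ∈ W.fineSelmerInfty κ :=
  resH1Hom_id_mem_fineSelmerInfty κ
    (AddSubgroup.inclusion (geomTorsion_le_geomPrimaryTorsion W p)) (fun _ _ ↦ rfl) (fun _ _ ↦ rfl) hy

omit [NumberField K] [Fact p.Prime] in
/-- The image lies in the `p`-torsion of `Sel₀(K_∞, E[p^∞])`. [cite: LimSujatha2018, §3] -/
theorem p_smul_torsionToPrimaryH1Sub_eq_zero (H : Subgroup (absoluteGaloisGroup K))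
    (y : subgroupH1 H (geomTorsion W (p : ℤ))) : p • W.torsionToPrimaryH1Sub p H y = 0 := by
  rw [← map_nsmul, p_smul_subgroupH1_geomTorsion_eq_zero, map_zero]

/-- **`Sel₀(K_∞, E[p^∞])[p]` finite ⟹ `Sel₀(K_∞, E[p])` finite** (any number field `K`, any elliptic
`W/K`, any prime `p`, any `ℤ_p`-extension `κ`): `Sel₀(K_∞, E[p])` lies in the preimage under
`(E[p] ↪ E[p^∞])_*` — a map with FINITE kernel `E(K_∞)[p^∞]/p` (`finite_ker_torsionToPrimaryH1Sub`) —
of the `p`-torsion classes of `Sel₀(K_∞, E[p^∞])`. One half of Lim–Sujatha's lemma "`Y(A/F^cyc)` is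
finitely generated over `𝒪` iff `R(A[π]/F^cyc)` is finite". [cite: LimSujatha2018, §3 (proof of Prop. 3.2)] [cite: GreenbergLNM1716, §3 (proof of Lemma 3.1)] -/
theorem finite_fineSelmerInfty_torsion_of_finite_pTorsion [W.IsElliptic]
    (hfin : Set.Finite {s : W.fineSelmerInfty κ | p • s = 0}) :
    (fineSelmerInfty (↥(geomTorsion W (p : ℤ))) κ :
      Set (subgroupH1 κ.kerSubgroup (geomTorsion W (p : ℤ)))).Finite := by
  set ι := W.torsionToPrimaryH1Sub p κ.kerSubgroup with hι
  -- the finite target: `p`-torsion classes of `Sel₀(K_∞, E[p^∞])`, as a subset of `H¹(K_∞, E[p^∞])`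
  set T : Set (W.subgroupH1 p κ.kerSubgroup) :=
    {x | x ∈ W.fineSelmerInfty κ ∧ p • x = 0} with hT
  have hTfin : T.Finite := by
    have : T = (fun s : W.fineSelmerInfty κ ↦ (s : W.subgroupH1 p κ.kerSubgroup)) ''
        {s : W.fineSelmerInfty κ | p • s = 0} := by
      ext x
      simp only [hT, Set.mem_setOf_eq, Set.mem_image]
      constructor
      · rintro ⟨hx, hpx⟩
        exact ⟨⟨x, hx⟩, Subtype.ext (by rw [AddSubgroupClass.coe_nsmul]; exact hpx), rfl⟩
      · rintro ⟨s, hs, rfl⟩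
        exact ⟨s.2, by rw [← AddSubgroupClass.coe_nsmul, hs]; rfl⟩
    rw [this]
    exact hfin.image _
  have hker : ((ι.ker : AddSubgroup (subgroupH1 κ.kerSubgroup (geomTorsion W (p : ℤ)))) :
      Set (subgroupH1 κ.kerSubgroup (geomTorsion W (p : ℤ)))).Finite :=
    W.finite_ker_torsionToPrimaryH1Sub p (H := κ.kerSubgroup) W.zsmul_geomPoints_surjective_holds
  refine (AddMonoidHom.finite_preimage_of_finite_ker ι hker hTfin).subset fun y hy ↦ ?_
  exact ⟨torsionToPrimaryH1Sub_mem_fineSelmerInfty W κ hy,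
    p_smul_torsionToPrimaryH1Sub_eq_zero W κ.kerSubgroup y⟩

end Torsion

end Literature.NumberTheory.EllipticCurves.FineSelmerCoefficientMap

end
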